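import Literature.NumberTheory.EllipticCurves.HeegnerPointsOfConductorGaloisOrbitProofs
import Literature.NumberTheory.EllipticCurves.HeegnerPointsOfConductorPrimeLevelProofs
import Literature.NumberTheory.EllipticCurves.SingularModuliClassGroupAction
import Literature.NumberTheory.EllipticCurves.ComplexMultiplicationClassPolynomialRootProofs
import Literature.NumberTheory.EllipticCurves.HeegnerPointsClassesProofs
import Literature.NumberTheory.EllipticCurves.SingularModuliConjugate
import Literature.NumberTheory.EllipticCurves.ModularPolynomialLevelTwo
import Literature.NumberTheory.EllipticCurves.Darmon2004.HeegnerNormCompatibilityInertProofs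
import Literature.NumberTheory.QuadraticFields.FundamentalDiscriminant
import HarnessLib

/-!
# Shimura reciprocity at conductor `m` under BIRCH's condition, and the PINNING of the
# Fricke partner across conductors (inputs of Gross 1991, Prop. 5.3 for the genus Kolyvagin system)

Topic `NumberTheory/EllipticCurves` (complex multiplication on `X₀(N)`; sequel of
`HeegnerPointsOfConductorGaloisOrbitProofs`, `HeegnerPointsOfConductorPrimeLevelProofs`,
`SingularModuliClassGroupAction`). THEOREMS ONLY (no definition, no named fact, no `sorry`);
class-field-theory-free, on the tree's `Aut(ℂ)`-transport of level structures.

## What is proved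

Throughout `K` is imaginary quadratic with `d_K = D`, `ι : K → ℂ`, `β` an orientation with
`4N ∣ β² − D`, written `β² − D = 4NC` (so `C = (β² − D)/(4N) > 0`), `x(m)` Gross's Heegner point of
conductor `m` (root of `Q_m = (m²NC, mβ, 1)`), and `Q*_m = (N, mβ, m²C)` its FRICKE PARTNER
(`negB (fricke N Q*_m) = Q_m`; `τ_{Q*_m}` is the point with `J • x(m) = w_N • τ_{Q*_m}`, the input of
Gross's proof of Prop. 5.3, *"`x_n^τ = w_N(x_n^{σ′})`"*).

* §1 helpers: scaling a form does not move its CM point (`heegnerTau_smul_eq`); `m·x(m) = x(1)`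
  (`levelPoint_heegnerPointOfConductor`); (`j(τ_{(A,B,C)}) = j(τ_{(C,−B,A)})` is the tree's `ModularPolynomialTwo.formJ_eq_formJ_flip`).
* §2 **Birch primitivity**: for `gcd(m, N) = 1` the Fricke partner `Q*_m` is a (primitive) Heegner form
  of level `N` and discriminant `m²D` — WITHOUT the Heegner hypothesis `gcd(N, D) = 1`: a common prime
  `r` of `N, mβ, m²C` divides `β` and `C`, so `r² ∣ β² − 4NC = d_K`, impossible for `r` odd
  (`not_sq_dvd_discr_of_prime_ne_two`) and for `r = 2` by the dyadic condition `d_K/4 ≡ 2, 3 (mod 4)`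
  (`discr_div_four_emod_four`) — `fricke_partner_mem_heegnerForms_of_coprime`.
* §3 **Shimura transitivity at conductor `m` under Birch's condition**
  (`exists_ringEquiv_levelTransport_heegnerPointOfConductor_birch`): for EVERY Heegner form `Q` of
  level `N`, discriminant `m²D`, residue `mβ (mod 2N)`, some `σ ∈ Aut(ℂ/ι(K))` has
  `LevelTransport N σ x(m) τ_Q` — the sibling's `exists_ringEquiv_levelTransport_heegnerPointOfConductor`
  with its hypothesis `gcd(N, d_K) = 1` (and `gcd(m, N) = 1`) REMOVED, by running the same proof on the
  primitive engine `levelTransport_of_transport_lattice_eq_of_primitive`; the restriction of such a `σ`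
  to `K[m]` is an element of `𝒢_m` (the tree's `Darmon2004.exists_mem_ringClassGal_coe_eq`) carrying any `K[m]`-point `y`
  over `φ(x(m))` to a point over `φ(τ_Q)` (`map_pointGalHom_eq_phi_of_levelTransport`).
* §4 **THE PINNING LEMMA** (`apply_kleinJ_heegnerPointOfConductor_one_of_levelTransport`): if
  `σ ∈ Aut(ℂ)` fixes `√D` and carries the level-`N` structure of `x(m)` to that of the Fricke partner
  `τ_{Q*_m}` (`gcd(m, N) = 1`), then `σ(j(x(1))) = j(τ_{Q*_1})`. Proof: `Q_m` is ALSO a Heegner form of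
  LEVEL `m` (discriminant `m²D`), whose level-`m` partner point is `m·x(m) = x(1)`; the form
  `Q′ = (m²C, −mβ, N) ∼ Q*_m` (by `S`) is a level-`m` Heegner form with the same residue `mβ (mod 2m)`,
  and `Λ_{x(m)}^σ ∼ Λ_{τ_{Q*_m}} ∼ Λ_{τ_{Q′}}`; so the primitive engine AT LEVEL `m` gives
  `LevelTransport m σ x(m) τ_{Q′}`, whence `σ(j(m·x(m))) = j(m·τ_{Q′}) = j(τ_{(mC, −mβ, mN)}) =
  j(τ_{(C, −β, N)}) = j(τ_{(N, β, C)})`. In ideal language: `σ ↔ [𝔫 ∩ 𝒪_m]^{±1} ∈ Pic(𝒪_m)` restricts on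
  `K[1]` to `[𝔫]^{±1} ∈ Pic(𝒪_K)` — the `n`-independence recorded by the named fact
  `GrossLMS1991.prop53_conj_pinned_birch` (`HeegnerPointsOfConductorConjugationBirch.lean`), whose
  discharge (sequel file) this lemma feeds.

## References
* [Darmon2004] H. Darmon, *Rational Points on Modular Elliptic Curves*, CBMS 101 (2004), Thm. 3.6,
  Thm. 3.7 (PDF pp. 43–44), Prop. 3.11.
* [GrossLMS1991] B. H. Gross, *Kolyvagin's work on modular elliptic curves* (1991), §3, §5 Prop. 5.3
  and proof (PDF p. 220).
* [Gross1984] B. H. Gross, *Heegner points on `X₀(N)`* (1984), §I.1, §5.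
* [Cox2013] D. A. Cox, *Primes of the form x² + ny²*, 2nd ed., Thm. 7.7, Prop. 7.20, Thm. 10.9, Thm. 11.1.
* [DiamondShurman2005] F. Diamond, J. Shurman, *A First Course in Modular Forms*, Thm. 1.5.1.

## Tree search
By name: `levelTransport_of_transport_lattice_eq_of_primitive`, `exists_ringEquiv_apply_formJ_principalForm_eq`,
`exists_lattice_eq_mulLeft_of_j_eq`, `LevelTransport.apply_kleinJ_eq_and`, `heegnerTau_divLevel`,
`ModularPolynomialTwo.formJ_eq_formJ_flip`, `Darmon2004.exists_mem_ringClassGal_coe_eq`, `eq_heegnerTau_of_isRoot`, `coe_heegnerPointOfConductor_eq_div`,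
`ringEquiv_apply_mem_ringClassField_iff`, `ModularParametrizationData.isAutEquivariantOnHeegner`,
`not_sq_dvd_discr_of_prime_ne_two`, `discr_div_four_emod_four`. `lean search 'pinned|_birch_holds|GaloisOrbitBirch'`:
no prior theorem of §2–§4.
-/

noncomputable section

open scoped Classical

namespace Literature.NumberTheory.EllipticCurves

open Complex UpperHalfPlane PeriodPair ModularForms NumberField
open Literature.NumberTheory.QuadraticFields.BinaryQuadraticForm
open Literature.NumberTheory.QuadraticFields.Quadratic
open Literature.NumberTheory.QuadraticFields

/-! ### §1 Helpers: scaling, `m·x(m) = x(1)`, the `S`-swap -/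

/-- `√(m²D) = m√D` for the normalised square roots `sqrtDisc`. [folklore] -/
private theorem sqrtDisc_natSq_mul (D : ℤ) (m : ℕ) :
    sqrtDisc ((m : ℤ) ^ 2 * D) = (m : ℂ) * sqrtDisc D := by
  unfold sqrtDisc
  have hm : (0 : ℝ) ≤ m := Nat.cast_nonneg m
  have h : -(((m : ℤ) ^ 2 * D : ℤ) : ℝ) = (m : ℝ) ^ 2 * (-(D : ℝ)) := by push_cast; ring
  rw [h, Real.sqrt_mul (sq_nonneg _), Real.sqrt_sq hm]
  push_cast
  ring

/-- **Scaling a form does not move its CM point**: `τ_{(kA, kB, kC)} = τ_{(A, B, C)}` for `k > 0`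
(both are the root in `ℍ` of `AX² + BX + C`; `eq_heegnerTau_of_isRoot`; Cox §7.B, the root `τ` of a form depends
only on the form up to scaling). [cite: Cox2013, §7.B (the root of a positive definite form)] -/
theorem heegnerTau_smul_eq {A B C k : ℤ} (hk : 0 < k) (hA : 0 < A) (hQ : B ^ 2 - 4 * A * C < 0) :
    heegnerTau (k * A, k * B, k * C) = heegnerTau (A, B, C) := by
  have hA' : 0 < k * A := mul_pos hk hA
  have hQ' : (k * B) ^ 2 - 4 * (k * A) * (k * C) < 0 := by
    have : (k * B) ^ 2 - 4 * (k * A) * (k * C) = k ^ 2 * (B ^ 2 - 4 * A * C) := by ring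
    rw [this]; exact mul_neg_of_pos_of_neg (pow_pos hk 2) hQ
  symm
  refine eq_heegnerTau_of_isRoot (Q := (k * A, k * B, k * C)) hA' hQ' (heegnerTau (A, B, C)) ?_
  have hroot := heegnerTau_isRoot (Q := (A, B, C)) hA hQ
  dsimp only at hroot ⊢
  push_cast
  linear_combination (k : ℂ) * hroot

/-- **`m · x(m) = x(1)`**: the level-`m` partner point of Gross's Heegner point of conductor `m` is the
Heegner point of conductor `1` (`x(m) = x(1)/m`, `coe_heegnerPointOfConductor_eq_div`).
[cite: GrossLMS1991, §3 (the point x_n)] -/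
theorem levelPoint_heegnerPointOfConductor {D β : ℤ} (hD : D < 0) (h4 : (4 : ℤ) ∣ β ^ 2 - D)
    {n : ℕ} [NeZero n] :
    levelPoint n (heegnerPointOfConductor D β n) = heegnerPointOfConductor D β 1 := by
  apply UpperHalfPlane.ext
  rw [coe_levelPoint, coe_heegnerPointOfConductor_eq_div hD h4 (NeZero.ne n)]
  have hn : (n : ℂ) ≠ 0 := by exact_mod_cast NeZero.ne n
  field_simp

/-! ### §2 Birch primitivity of the Fricke partner `Q*_m = (N, mβ, m²C)` -/

section Birch

variable {K : Type*} [Field K] [NumberField K]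

/-- **No common divisor of `N, mβ, m²C` beyond units**, for `β² − d_K = 4NC` and `gcd(m, N) = 1`: a
common prime `r` has `r ∤ m`, so `r ∣ β`, `r ∣ C`, hence `r² ∣ β² − 4NC = d_K` — excluded for odd `r`
by `not_sq_dvd_discr_of_prime_ne_two` and for `r = 2` by `discr_div_four_emod_four`
(`d_K/4 ≡ 2, 3 (mod 4)`, while `β²/4 − NC ≡ 0, 1 (mod 4)` when `2 ∣ β, N, C`). This is the primitivity
of Gross's Heegner points `(𝒪_n, 𝔫 ∩ 𝒪_n)` for `d_K ≡ β² (mod 4N)` (Gross 1984 §I.1: fundamental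
discriminants give primitive forms). [cite: Gross1984, §I.1 (Heegner points for D ≡ β² mod 4N)] -/
theorem isUnit_of_dvd_fricke_partner (h2 : Module.finrank ℚ K = 2) {N : ℕ} {β C : ℤ}
    (hC : β ^ 2 - NumberField.discr K = 4 * N * C) {m : ℕ} (hmN : m.Coprime N)
    {d : ℤ} (hdN : d ∣ (N : ℤ)) (hdB : d ∣ (m : ℤ) * β) (hdC : d ∣ (m : ℤ) ^ 2 * C) : IsUnit d := by
  by_contra hd
  have hd1 : d.natAbs ≠ 1 := fun h => hd (Int.isUnit_iff_natAbs_eq.mpr h)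
  obtain ⟨p, hp, hpd⟩ := Int.exists_prime_and_dvd hd1
  have hpN : p ∣ (N : ℤ) := hpd.trans hdN
  -- `p ∤ m` since `gcd(m, N) = 1`
  have hpm : ¬ p ∣ (m : ℤ) := by
    intro h
    have h1 : p ∣ ((Int.gcd (m : ℤ) (N : ℤ) : ℕ) : ℤ) := Int.dvd_coe_gcd h hpN
    rw [Int.gcd_natCast_natCast, hmN, Nat.cast_one] at h1
    exact hp.not_unit (isUnit_of_dvd_one h1)
  have hpβ : p ∣ β := (hp.dvd_or_dvd (hpd.trans hdB)).resolve_left hpm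
  have hpC : p ∣ C := by
    rcases hp.dvd_or_dvd (hpd.trans hdC) with h | h
    · exact absurd (hp.dvd_of_dvd_pow h) hpm
    · exact h
  -- `p² ∣ d_K`
  have hp2 : p ^ 2 ∣ NumberField.discr K := by
    have hD : NumberField.discr K = β ^ 2 - 4 * N * C := by linear_combination -hC
    rw [hD]
    exact dvd_sub (pow_dvd_pow_of_dvd hpβ 2)
      (by rw [sq]; exact Dvd.dvd.mul_left (mul_dvd_mul hpN hpC) 4 |>.trans (by ring_nf; rfl))
  set q : ℕ := p.natAbs with hq
  have hqp : q.Prime := Int.prime_iff_natAbs_prime.mp hp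
  have hq2 : ((q : ℤ)) ^ 2 ∣ NumberField.discr K := by
    rw [hq, Int.natAbs_sq p]; exact hp2
  by_cases hq2' : q = 2
  · -- dyadic case
    have h4 : (4 : ℤ) ∣ NumberField.discr K := by
      have : ((q : ℤ)) ^ 2 = 4 := by rw [hq2']; norm_num
      rwa [this] at hq2
    have hm4 := discr_div_four_emod_four h2 h4
    have h2β : (2 : ℤ) ∣ β := by
      have := Int.natAbs_dvd.mpr hpβ; rwa [← hq, hq2'] at this
    have h2N : (2 : ℤ) ∣ (N : ℤ) := by
      have := Int.natAbs_dvd.mpr hpN; rwa [← hq, hq2'] at this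
    have h2C : (2 : ℤ) ∣ C := by
      have := Int.natAbs_dvd.mpr hpC; rwa [← hq, hq2'] at this
    obtain ⟨b, rfl⟩ := h2β
    obtain ⟨N', hN'⟩ := h2N
    obtain ⟨C', rfl⟩ := h2C
    have hD : NumberField.discr K = 4 * (b ^ 2 - 4 * N' * C') := by
      have : (N : ℤ) = 2 * N' := hN'
      linear_combination (-1 : ℤ) * hC - (8 * C') * this
    have hD4 : NumberField.discr K / 4 = b ^ 2 - 4 * N' * C' := by
      rw [hD, Int.mul_ediv_cancel_left _ (by norm_num)]
    rw [hD4] at hm4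
    rcases Int.even_or_odd' b with ⟨c, hc | hc⟩
    · have : (b ^ 2 - 4 * N' * C') % 4 = 0 := by
        rw [hc]; ring_nf; omega
      omega
    · have : (b ^ 2 - 4 * N' * C') % 4 = 1 := by
        rw [hc]; ring_nf; omega
      omega
  · exact not_sq_dvd_discr_of_prime_ne_two h2 hqp hq2' hq2

/-- **The Fricke partner `Q*_m = (N, mβ, m²C)` is a Heegner form of level `N` and discriminant `m²d_K`,
under Birch's condition `β² − d_K = 4NC` and `gcd(m, N) = 1`** (no Heegner hypothesis: primes dividing
both `N` and `d_K` allowed). [cite: Gross1984, §I.1] -/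
theorem fricke_partner_mem_heegnerForms_of_coprime (hK : IsImaginaryQuadratic K) {N : ℕ} [NeZero N]
    {β C : ℤ} (hC : β ^ 2 - NumberField.discr K = 4 * N * C) {m : ℕ} (hmN : m.Coprime N) :
    ((N : ℤ), (m : ℤ) * β, (m : ℤ) ^ 2 * C) ∈ heegnerForms N ((m : ℤ) ^ 2 * NumberField.discr K) := by
  have hN0 : (0 : ℤ) < N := by exact_mod_cast NeZero.pos N
  refine ⟨?_, hN0, dvd_rfl, fun d hdN hdB hdC => ?_⟩
  · show ((m : ℤ) * β) ^ 2 - 4 * (N : ℤ) * ((m : ℤ) ^ 2 * C) = (m : ℤ) ^ 2 * NumberField.discr K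
    linear_combination ((m : ℤ) ^ 2) * hC
  · exact isUnit_of_dvd_fricke_partner hK.1 hC hmN hdN hdB hdC

end Birch

/-! ### §3 Shimura transitivity at conductor `m` under Birch's condition -/

section Transitivity

variable {K : Type} [Field K] [NumberField K]

/-- **Shimura reciprocity at conductor `m`, transport form, under BIRCH's condition**: for `K` imaginary
quadratic, `ι : K → ℂ`, `4N ∣ β² − d_K`, `m ≠ 0`, and ANY Heegner form `Q` of level `N`, discriminant
`m²d_K` and residue `B ≡ mβ (mod 2N)`, there is `σ ∈ Aut(ℂ/ι(K))` with `LevelTransport N σ x(m) τ_Q`.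
The sibling `exists_ringEquiv_levelTransport_heegnerPointOfConductor` assumes `gcd(N, d_K) = 1` and
`gcd(m, N) = 1`; both are dropped here by running its proof on the primitive engine
`levelTransport_of_transport_lattice_eq_of_primitive` (Darmon 2004 Thm. 3.7; Gross 1984 §I.1 allows
primes dividing both `N` and `d_K`). [cite: Darmon2004, Thm. 3.7 (PDF p. 44)] [cite: Gross1984, §I.1] -/
theorem exists_ringEquiv_levelTransport_heegnerPointOfConductor_birch (hK : IsImaginaryQuadratic K)
    (ι : K →+* ℂ) {N : ℕ} [NeZero N] {β : ℤ} (hβ : (4 * N : ℤ) ∣ β ^ 2 - NumberField.discr K)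
    {m : ℕ} (hm : m ≠ 0) {Q : ℤ × ℤ × ℤ}
    (hQ : Q ∈ heegnerForms N ((m : ℤ) ^ 2 * NumberField.discr K))
    (hQβ : Q.2.1 ≡ m * β [ZMOD 2 * N]) :
    ∃ σ : ℂ ≃+* ℂ, (∀ k : K, σ (ι k) = ι k) ∧
      LevelTransport N σ (heegnerPointOfConductor (NumberField.discr K) β m) (heegnerTau Q) := by
  set D : ℤ := NumberField.discr K
  have hD : D < 0 := hK.discr_neg
  have hm0 : (0 : ℤ) < m := by exact_mod_cast Nat.pos_of_ne_zero hm
  have hDm : (m : ℤ) ^ 2 * D < 0 := mul_neg_of_pos_of_neg (pow_pos hm0 2) hD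
  obtain ⟨hQ₀, hQ₀β⟩ := heegnerFormOfConductor_mem_heegnerForms (N := N) hD hβ hm
  set Q₀ : ℤ × ℤ × ℤ := heegnerFormOfConductor D β m
  have hQ' := hQ
  obtain ⟨hdisc, hA, -, hprim⟩ := hQ'
  have hQ₀' := hQ₀
  obtain ⟨hdisc₀, hA₀, -, hprim₀⟩ := hQ₀'
  have hprimQ : IsPrimitive Q :=
    (isPrimitive_iff_binQF Q).mpr ((BinQF.isPrimitive_iff _).mpr hprim)
  have hprimQ₀ : IsPrimitive Q₀ :=
    (isPrimitive_iff_binQF Q₀).mpr ((BinQF.isPrimitive_iff _).mpr hprim₀)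
  have hdiscQ : discr Q = (m : ℤ) ^ 2 * D := hdisc
  have hdiscQ₀ : discr Q₀ = (m : ℤ) ^ 2 * D := hdisc₀
  obtain ⟨σ₁, hσ₁K, hσ₁j⟩ :=
    exists_ringEquiv_apply_formJ_principalForm_eq hK ι hA hprimQ (by rw [hdiscQ]; exact hDm)
  obtain ⟨σ₂, hσ₂K, hσ₂j⟩ :=
    exists_ringEquiv_apply_formJ_principalForm_eq hK ι hA₀ hprimQ₀ (by rw [hdiscQ₀]; exact hDm)
  rw [hdiscQ] at hσ₁j
  rw [hdiscQ₀] at hσ₂j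
  refine ⟨σ₂.symm.trans σ₁, fun k ↦ ?_, ?_⟩
  · rw [RingEquiv.trans_apply, (RingEquiv.symm_apply_eq σ₂).mpr (hσ₂K k).symm, hσ₁K k]
  have hσK : ∀ k : K, (σ₂.symm.trans σ₁) (ι k) = ι k := fun k ↦ by
    rw [RingEquiv.trans_apply, (RingEquiv.symm_apply_eq σ₂).mpr (hσ₂K k).symm, hσ₁K k]
  have hσj : (σ₂.symm.trans σ₁) (formJ Q₀) = formJ Q := by
    rw [RingEquiv.trans_apply, (RingEquiv.symm_apply_eq σ₂).mpr hσ₂j.symm, hσ₁j]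
  have hσD : (σ₂.symm.trans σ₁) (sqrtDisc ((m : ℤ) ^ 2 * D)) = sqrtDisc ((m : ℤ) ^ 2 * D) := by
    rw [sqrtDisc_natSq_mul, map_mul, map_natCast, apply_sqrtDisc_discr_eq hK ι hσK]
  obtain ⟨M, hM⟩ := exists_isTransportedBy (σ₂.symm.trans σ₁) (ofUpperHalfPlane (heegnerTau Q₀))
  have hjM : (ofUpperHalfPlane (heegnerTau Q)).j = M.j := by
    rw [hM.j_eq, ← formJ_def, ← formJ_def, hσj]
  obtain ⟨c, hc, hMc⟩ := exists_lattice_eq_mulLeft_of_j_eq hjM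
  exact levelTransport_of_transport_lattice_eq_of_primitive hDm hσD hQ₀ hQ₀β hQ hQβ hM hc hMc

/-- **The parametrisation along the transport**: if `σ ∈ Aut(ℂ/ι(K))` carries the level-`N` structure of
`x(m)` to that of `τ_Q` (`Q` a Heegner form of level `N`, discriminant `m²d_K`), `σ' ∈ Aut(K[m])` agrees with
`σ` on `K[m]`, and `y ∈ E(K[m])` lies over `φ(x(m))`, then `σ' • y` lies over `φ(τ_Q)` — Darmon 2004,
Thm. 3.7 read through the `Aut(ℂ)`-equivariance of `φ` (`isAutEquivariantOnHeegner`).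
[cite: Darmon2004, Thm. 3.7 (PDF p. 44), Thm. 3.6 (PDF p. 43)] -/
theorem map_pointGalHom_eq_phi_of_levelTransport (hK : IsImaginaryQuadratic K) (ι : K →+* ℂ)
    {N : ℕ} [NeZero N] {W : WeierstrassCurve ℚ} (Dt : ModularParametrizationData W N) {β : ℤ}
    (hβ : (4 * N : ℤ) ∣ β ^ 2 - NumberField.discr K) {m : ℕ} (hm : m ≠ 0)
    {Q : ℤ × ℤ × ℤ} (hQ : Q ∈ heegnerForms N ((m : ℤ) ^ 2 * NumberField.discr K))
    {σ : ℂ ≃+* ℂ} (hσK : ∀ k : K, σ (ι k) = ι k)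
    (hT : LevelTransport N σ (heegnerPointOfConductor (NumberField.discr K) β m) (heegnerTau Q))
    {σ' : ringClassField K ι m ≃ₐ[ℚ] ringClassField K ι m}
    (hσ' : ∀ x : ringClassField K ι m, ((σ' x : ringClassField K ι m) : ℂ) = σ x)
    {y : (W.baseChange (ringClassField K ι m)).toAffine.Point}
    (hy : WeierstrassCurve.Affine.Point.map (ringClassField K ι m).subtype.toRatAlgHom y =
      heegnerPointComplexOfConductor Dt (NumberField.discr K) β m) :
    WeierstrassCurve.Affine.Point.map (W' := W) (ringClassField K ι m).subtype.toRatAlgHom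
        (pointGalHom W (ringClassField K ι m) σ' y) = Dt.φ (heegnerTau Q) := by
  set D : ℤ := NumberField.discr K
  have hD : D < 0 := hK.discr_neg
  obtain ⟨hQ₀, -⟩ := heegnerFormOfConductor_mem_heegnerForms (N := N) hD hβ hm
  have hσD : σ (sqrtDisc ((m : ℤ) ^ 2 * D)) = sqrtDisc ((m : ℤ) ^ 2 * D) := by
    rw [sqrtDisc_natSq_mul, map_mul, map_natCast, apply_sqrtDisc_discr_eq hK ι hσK]
  have hφ : Dt.IsAutEquivariantOnHeegner ((m : ℤ) ^ 2 * D) := Dt.isAutEquivariantOnHeegner _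
  have hy' : WeierstrassCurve.Affine.Point.map (ringClassField K ι m).subtype.toRatAlgHom y =
      Dt.φ (heegnerTau (heegnerFormOfConductor D β m)) := by
    simpa only [heegnerPointComplexOfConductor, heegnerPointOfConductor] using hy
  calc WeierstrassCurve.Affine.Point.map (ringClassField K ι m).subtype.toRatAlgHom
          (pointGalHom W (ringClassField K ι m) σ' y)
      = WeierstrassCurve.Affine.Point.map ((σ : ℂ →+* ℂ)).toRatAlgHom
          (WeierstrassCurve.Affine.Point.map (ringClassField K ι m).subtype.toRatAlgHom y) := by
        rw [pointGalHom_apply, WeierstrassCurve.Affine.Point.map_map,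
          WeierstrassCurve.Affine.Point.map_map]
        exact WeierstrassCurve.Affine.Point.map_congr_fun (fun x ↦ hσ' x) _
    _ = Dt.φ (heegnerTau Q) := by
        rw [hy']
        exact hφ σ hσD hQ₀ hQ hT

end Transitivity

/-! ### §4 The pinning lemma: the Fricke partner's transport restricts the same way at every conductor -/

section Pinning

/-- **PINNING.** Let `D < 0`, `β² − D = 4NC`, `n ≠ 0` prime to `N`, `(N, β, C)` primitive, and let
`σ ∈ Aut(ℂ)` fix `√D` and carry the level-`N` structure of `x(n)` to that of the Fricke partner
`τ_{(N, nβ, n²C)}`. Then `σ(j(x(1))) = j(τ_{(N, β, C)})`. Proof: the Heegner form `Q_n = (n²NC, nβ, 1)` of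
`x(n)` is also a Heegner form of LEVEL `n` and discriminant `n²D`, with level-`n` partner point
`n·x(n) = x(1)`; `Q′ = (n²C, −nβ, N)` is a level-`n` Heegner form of discriminant `n²D` with the same residue
`nβ (mod 2n)` and `j(τ_{Q′}) = j(τ_{(N, nβ, n²C)}) = σ(j(x(n)))`, so `Λ_{x(n)}^σ ∼ Λ_{τ_{Q′}}` (Cox Thm. 10.9)
and the primitive engine at level `n` gives `LevelTransport n σ x(n) τ_{Q′}`; its second half reads
`σ(j(x(1))) = j(n·τ_{Q′}) = j(τ_{(nC, −nβ, nN)}) = j(τ_{(C, −β, N)}) = j(τ_{(N, β, C)})`. (Ideal-theoretically: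
the element of `Pic(𝒪_n)` carrying `[𝒪_n]` to `[𝔫 ∩ 𝒪_n]^{±1}` extends to `[𝔫]^{±1} ∈ Pic(𝒪_K)`, Cox
Prop. 7.20 — here obtained without ideals.) [cite: Cox2013, Thm. 10.9, Prop. 7.20]
[cite: DiamondShurman2005, Thm. 1.5.1] [cite: Gross1984, §I.1, §5] -/
theorem apply_kleinJ_heegnerPointOfConductor_one_of_levelTransport {D β C : ℤ} {N : ℕ} [NeZero N]
    (hD : D < 0) (hC : β ^ 2 - D = 4 * N * C) {n : ℕ} (hn : n ≠ 0) (hnN : n.Coprime N)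
    (hprim : ∀ d : ℤ, d ∣ (N : ℤ) → d ∣ β → d ∣ C → IsUnit d)
    {σ : ℂ ≃+* ℂ} (hσ : σ (sqrtDisc D) = sqrtDisc D)
    (hT : LevelTransport N σ (heegnerPointOfConductor D β n)
      (heegnerTau ((N : ℤ), (n : ℤ) * β, (n : ℤ) ^ 2 * C))) :
    σ (kleinJ (heegnerPointOfConductor D β 1)) = kleinJ (heegnerTau ((N : ℤ), β, C)) := by
  haveI : NeZero n := ⟨hn⟩
  have hn0 : (0 : ℤ) < n := by exact_mod_cast Nat.pos_of_ne_zero hn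
  have hN0 : (0 : ℤ) < N := by exact_mod_cast NeZero.pos N
  have hDn : (n : ℤ) ^ 2 * D < 0 := mul_neg_of_pos_of_neg (pow_pos hn0 2) hD
  have h4 : (4 : ℤ) ∣ β ^ 2 - D := ⟨N * C, by rw [hC]; ring⟩
  have hNC : (β ^ 2 - D) / 4 = N * C := by
    rw [hC, show (4 : ℤ) * N * C = 4 * (N * C) by ring, Int.mul_ediv_cancel_left _ (by norm_num)]
  have hCpos : 0 < C := by
    have h1 : 0 < β ^ 2 - D := by nlinarith [sq_nonneg β]
    rw [hC] at h1
    by_contra hle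
    push Not at hle
    have : 4 * (N : ℤ) * C ≤ 0 := mul_nonpos_of_nonneg_of_nonpos (by positivity) hle
    exact absurd h1 (not_lt.mpr this)
  -- the source form `Q_n = (n²NC, nβ, 1)` as a Heegner form of LEVEL `n`
  have hQn_eq : heegnerFormOfConductor D β n = ((n : ℤ) ^ 2 * (N * C), (n : ℤ) * β, 1) := by
    simp [heegnerFormOfConductor, hNC]
  have hQn : heegnerFormOfConductor D β n ∈ heegnerForms n ((n : ℤ) ^ 2 * D) := by
    rw [hQn_eq]
    refine ⟨?_, ?_, ⟨(n : ℤ) * (N * C), by ring⟩, fun d _ _ hd ↦ isUnit_of_dvd_one hd⟩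
    · show ((n : ℤ) * β) ^ 2 - 4 * ((n : ℤ) ^ 2 * (N * C)) * 1 = (n : ℤ) ^ 2 * D
      linear_combination ((n : ℤ) ^ 2) * hC
    · exact mul_pos (pow_pos hn0 2) (mul_pos hN0 hCpos)
  have hQnβ : (heegnerFormOfConductor D β n).2.1 ≡ (n : ℤ) * β [ZMOD 2 * n] := by
    rw [hQn_eq]
  -- the target form `Q' = (n²C, −nβ, N)`, a Heegner form of level `n`, residue `nβ (mod 2n)`
  have hQ' : ((n : ℤ) ^ 2 * C, -((n : ℤ) * β), (N : ℤ)) ∈ heegnerForms n ((n : ℤ) ^ 2 * D) := by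
    refine ⟨?_, mul_pos (pow_pos hn0 2) hCpos, ⟨(n : ℤ) * C, by ring⟩, fun d hdA hdB hdC ↦ ?_⟩
    · show (-((n : ℤ) * β)) ^ 2 - 4 * ((n : ℤ) ^ 2 * C) * N = (n : ℤ) ^ 2 * D
      linear_combination ((n : ℤ) ^ 2) * hC
    · -- `d ∣ N` and `gcd(n, N) = 1`: `d` is prime to `n`, so `d ∣ C` and `d ∣ β`
      dsimp only at hdA hdB hdC
      have hdB' : d ∣ (n : ℤ) * β := dvd_neg.mp hdB
      have hcop : IsCoprime d (n : ℤ) := by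
        have h1 : IsCoprime (N : ℤ) (n : ℤ) := Nat.isCoprime_iff_coprime.mpr hnN.symm
        exact h1.of_isCoprime_of_dvd_left hdC
      have hdC' : d ∣ C := by
        have : d ∣ (n : ℤ) ^ 2 * C := hdA
        exact (hcop.pow_right (n := 2)).dvd_of_dvd_mul_left this
      have hdβ : d ∣ β := hcop.dvd_of_dvd_mul_left hdB'
      exact hprim d hdC hdβ hdC'
  have hQ'β : ((n : ℤ) ^ 2 * C, -((n : ℤ) * β), (N : ℤ)).2.1 ≡ (n : ℤ) * β [ZMOD 2 * n] := by
    show -((n : ℤ) * β) ≡ (n : ℤ) * β [ZMOD 2 * n]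
    exact Int.modEq_iff_dvd.mpr ⟨β, by ring⟩
  -- `σ` fixes `√(n²D)`
  have hσn : σ (sqrtDisc ((n : ℤ) ^ 2 * D)) = sqrtDisc ((n : ℤ) ^ 2 * D) := by
    rw [sqrtDisc_natSq_mul, map_mul, map_natCast, hσ]
  -- `Λ_{x(n)}^σ ∼ Λ_{τ_{Q'}}`: same `j` as the level-`N` partner `(N, nβ, n²C)`, swapped by `S`
  have hswap : formJ ((N : ℤ), (n : ℤ) * β, (n : ℤ) ^ 2 * C) = formJ ((n : ℤ) ^ 2 * C, -((n : ℤ) * β), (N : ℤ)) := by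
    refine ModularPolynomialTwo.formJ_eq_formJ_flip hN0 ?_
    have : ((n : ℤ) * β) ^ 2 - 4 * (N : ℤ) * ((n : ℤ) ^ 2 * C) = (n : ℤ) ^ 2 * D := by
      linear_combination ((n : ℤ) ^ 2) * hC
    rw [this]; exact hDn
  obtain ⟨M, hM⟩ := exists_isTransportedBy σ (ofUpperHalfPlane (heegnerPointOfConductor D β n))
  have hjM : (ofUpperHalfPlane (heegnerTau ((n : ℤ) ^ 2 * C, -((n : ℤ) * β), (N : ℤ)))).j = M.j := by
    rw [hM.j_eq, ← kleinJ_eq_periodPair_j, ← kleinJ_eq_periodPair_j, hT.apply_kleinJ_eq_and.1,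
      ← formJ_eq_kleinJ, ← formJ_eq_kleinJ, hswap]
  obtain ⟨c, hc, hMc⟩ := exists_lattice_eq_mulLeft_of_j_eq hjM
  have hTn : LevelTransport n σ (heegnerPointOfConductor D β n)
      (heegnerTau ((n : ℤ) ^ 2 * C, -((n : ℤ) * β), (N : ℤ))) :=
    levelTransport_of_transport_lattice_eq_of_primitive (N := n) hDn hσn hQn hQnβ hQ' hQ'β hM hc hMc
  -- the second half of the level-`n` transport: `σ(j(n·x(n))) = j(n·τ_{Q'})`
  have h2 := hTn.apply_kleinJ_eq_and.2
  rw [levelPoint_heegnerPointOfConductor hD h4, ← heegnerTau_divLevel (N := n) hDn hQ'] at h2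
  rw [h2]
  -- `n·τ_{Q'} = τ_{(nC, −nβ, nN)} = τ_{(C, −β, N)}` and `j(τ_{(C, −β, N)}) = j(τ_{(N, β, C)})`
  have hdiv : ((n : ℤ) ^ 2 * C / n, -((n : ℤ) * β), (N : ℤ) * n) = ((n : ℤ) * C, (n : ℤ) * (-β), (n : ℤ) * N) := by
    refine Prod.ext ?_ (Prod.ext (by ring) (by ring))
    show (n : ℤ) ^ 2 * C / n = n * C
    rw [sq, mul_assoc, Int.mul_ediv_cancel_left _ (by exact_mod_cast hn)]
  have hdisc1 : β ^ 2 - 4 * (N : ℤ) * C < 0 := by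
    have : β ^ 2 - 4 * (N : ℤ) * C = D := by linear_combination hC
    rw [this]; exact hD
  rw [show (((n : ℤ) ^ 2 * C, -((n : ℤ) * β), (N : ℤ)) : ℤ × ℤ × ℤ).1 = (n : ℤ) ^ 2 * C from rfl,
    show (((n : ℤ) ^ 2 * C, -((n : ℤ) * β), (N : ℤ)) : ℤ × ℤ × ℤ).2.1 = -((n : ℤ) * β) from rfl,
    show (((n : ℤ) ^ 2 * C, -((n : ℤ) * β), (N : ℤ)) : ℤ × ℤ × ℤ).2.2 = (N : ℤ) from rfl, hdiv,
    heegnerTau_smul_eq hn0 hCpos (by nlinarith [hdisc1]), ← formJ_eq_kleinJ, ← formJ_eq_kleinJ,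
    ModularPolynomialTwo.formJ_eq_formJ_flip hN0 hdisc1]

end Pinning

end Literature.NumberTheory.EllipticCurves

end
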